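import Summits.ResolutionOfSingularities.ResolutionOfSingularities.Theorems.HilbertSamuelEliminationSigmaMaxModificationsCorridor3TameWildDefs
import Literature.AlgebraicGeometry.Resolution.HilbertSamuelLocal
import Literature.AlgebraicGeometry.Resolution.ResolutionGlue
import Mathlib.AlgebraicGeometry.Morphisms.Proper
import Mathlib.AlgebraicGeometry.Limits
import HarnessLib

/-!
# Route `HilbertSamuelElimination`, crux `SigmaMaxModificationsCorridor3`
# (stmt-ResolutionOfSingularities-19249; child of `SigmaMaxModifications` stmt-…-18506),
# line `tame_wild` — gluing a local `ν`-witness into a `ν`-modification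

[OURS · L1 W4.2] Helper for stub `stub_isolatedNu3` of the registered skeleton
`Cruxes/SigmaMaxModificationsCorridor3/Lines/tame_wild.lean` (item stmt-ResolutionOfSingularities-19249):
the purely scheme-theoretic GLUING step behind Cossart–Jannsen–Saito, LNM 2270, Def. 6.14 / Rem. 6.24
(`ν`-eliminations read as modifications), the `ν`-wise analogue of the landed
`sigmaMaxModification_of_localWitness` (p153270, whose gluing lemmas are private and are re-derived
here verbatim). NOT a statement of any manuscript.

Let `X` be a reduced locally Noetherian scheme of dimension `≤ d` and `≤ N`, `ν : ℕ → ℕ`, covered by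
the opens `Zc = X ∖ X(ν)` (`X(ν) = Scheme.hsStratum X N ν`) and `U₁`, and let `ρ : Y → U₁` be a "local
`ν`-witness": proper, `Y` reduced of dimension `≤ d` and `≤ N`, an isomorphism over `U₁ ∩ Zc`, pulling
dense opens of `X` inside `X ∖ X(ν)` back to dense opens of `Y`, `H^N` non-increasing along `ρ`, and
`ν ∉ Σ_Y(N)`. Then `ρ` extends BY THE IDENTITY over `Zc` to a `ν`-modification of `X` at level `N`
inside the class `{dim ≤ d}` (`NuMod X N d ν`, the Theorems-side copy of the line's definition).

Construction (Stacks 01LH / 01JA, gluing of schemes along opens, in Mathlib's form "pushouts of two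
open immersions exist and are computed by the locally directed gluing",
`Mathlib.AlgebraicGeometry.Limits`): `X'` is the pushout of `Y ↩ ρ⁻¹(U₁ ∩ Zc) ↪ Zc`; `π` is induced
by `ρ ≫ U₁.ι` and `Zc.ι`. The two structure maps `Y → X'`, `Zc → X'` are jointly surjective open
immersions with ranges `π⁻¹(U₁)`, `π⁻¹(Zc)`, so `π|_{U₁} ≅ ρ` is proper and `π|_{Zc} ≅ 𝟙` is an
isomorphism; reducedness, the dimension bounds, the density of preimages and the Hilbert–Samuel
clauses are checked through the two open charts.

## Sources

* V. Cossart, U. Jannsen, S. Saito, LNM 2270 (2020), Def. 2.28, Def. 6.14, Rem. 6.24.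
  [CossartJannsenSaito2020]
* The Stacks Project, Tags 01JA, 01LH (gluing of schemes), 02I4. [StacksProject]
-/

set_option linter.dupNamespace false -- mandated namespace of this single-conjunct summit

noncomputable section

open CategoryTheory CategoryTheory.Limits AlgebraicGeometry TopologicalSpace Topology
open Literature.AlgebraicGeometry.Resolution Literature.RingTheory.HilbertSamuel

namespace Summit.ResolutionOfSingularities.ResolutionOfSingularities.Theorems.SigmaMaxModificationsCorridor3.TameWild

universe u

/-! ## Pushouts of two open immersions: the structure maps
(adapted from `Theorems/HilbertSamuelEliminationSigmaMaxModificationsGluing.lean`, whose lemmas are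
private) -/

section Pushout

variable {W Y Z : Scheme.{u}} (f : W ⟶ Y) (g : W ⟶ Z) [IsOpenImmersion f] [IsOpenImmersion g]

/-- The first structure map of the pushout of two open immersions is an open immersion (the
pushout is Mathlib's locally directed gluing, Stacks 01JA). [cite: StacksProject, Tag 01JA] -/
private theorem isOpenImmersion_pushoutInl : IsOpenImmersion (pushout.inl f g) :=
  inferInstanceAs (IsOpenImmersion (colimit.ι (span f g) WalkingSpan.left))

/-- The second structure map of the pushout of two open immersions is an open immersion.
[cite: StacksProject, Tag 01JA] -/
private theorem isOpenImmersion_pushoutInr : IsOpenImmersion (pushout.inr f g) :=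
  inferInstanceAs (IsOpenImmersion (colimit.ι (span f g) WalkingSpan.right))

/-- The two structure maps of the pushout of two open immersions are jointly surjective.
[cite: StacksProject, Tag 01JA] -/
private theorem pushout_cases (x : ↑(pushout f g)) :
    (∃ y : Y, pushout.inl f g y = x) ∨ (∃ z : Z, pushout.inr f g z = x) := by
  obtain ⟨j, xj, h⟩ := Scheme.IsLocallyDirected.ι_jointly_surjective (span f g) x
  rcases j with _ | _ | _
  · left
    refine ⟨f xj, ?_⟩
    rw [← h, ← colimit.w (span f g) WalkingSpan.Hom.fst, Scheme.Hom.comp_apply]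
    rfl
  · exact Or.inl ⟨xj, h⟩
  · exact Or.inr ⟨xj, h⟩

end Pushout

/-! ## The glued scheme -/

/-- **Gluing along an open (Stacks 01LH / 01JA).** For opens `Zc, U₁ ⊆ X` and `ρ : Y → U₁` an
isomorphism over `U₁ ∩ Zc`, the pushout `X'` of `Y ↩ ρ⁻¹(U₁ ∩ Zc) ↪ Zc` carries `π : X' → X`
restricting to `ρ` over `U₁` and to the identity over `Zc`: the structure maps `Y → X'`,
`Zc → X'` are jointly surjective open immersions with ranges exactly `π⁻¹(U₁)` and `π⁻¹(Zc)`.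
[cite: StacksProject, Tag 01LH] -/
private theorem exists_glue {X Y : Scheme.{u}} (Zc U₁ : X.Opens) (ρ : Y ⟶ U₁)
    [IsIso (ρ ∣_ (U₁.ι ⁻¹ᵁ Zc))] :
    ∃ (X' : Scheme.{u}) (π : X' ⟶ X) (inl : Y ⟶ X') (inr : (Zc : Scheme.{u}) ⟶ X'),
      IsOpenImmersion inl ∧ IsOpenImmersion inr ∧ inl ≫ π = ρ ≫ U₁.ι ∧ inr ≫ π = Zc.ι ∧
      (∀ x' : X', (∃ y, inl y = x') ∨ (∃ z, inr z = x')) ∧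
      (∀ x' : X', (∃ y, inl y = x') ↔ π x' ∈ U₁) ∧
      (∀ x' : X', (∃ z, inr z = x') ↔ π x' ∈ Zc) := by
  -- the open immersion `ρ⁻¹(U₁ ∩ Zc) ≅ U₁ ∩ Zc ↪ Zc`
  obtain ⟨i₂, hi₂⟩ : ∃ i₂ : (↑(ρ ⁻¹ᵁ (U₁.ι ⁻¹ᵁ Zc)) : Scheme.{u}) ⟶ Zc,
      i₂ = (ρ ∣_ (U₁.ι ⁻¹ᵁ Zc)) ≫ (U₁.ι ∣_ Zc) := ⟨_, rfl⟩
  haveI : IsOpenImmersion i₂ := by rw [hi₂]; infer_instance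
  have hi₂π : i₂ ≫ Zc.ι = (ρ ⁻¹ᵁ (U₁.ι ⁻¹ᵁ Zc)).ι ≫ ρ ≫ U₁.ι := by
    rw [hi₂, Category.assoc, morphismRestrict_ι, morphismRestrict_ι_assoc]
  have hi₂pt : ∀ v : ↑(ρ ⁻¹ᵁ (U₁.ι ⁻¹ᵁ Zc)), (i₂ v).1 = U₁.ι (ρ v.1) := by
    intro v
    simp only [hi₂, Scheme.Hom.comp_apply, morphismRestrict_base_coe]
  haveI := isOpenImmersion_pushoutInl (ρ ⁻¹ᵁ (U₁.ι ⁻¹ᵁ Zc)).ι i₂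
  haveI := isOpenImmersion_pushoutInr (ρ ⁻¹ᵁ (U₁.ι ⁻¹ᵁ Zc)).ι i₂
  refine ⟨pushout (ρ ⁻¹ᵁ (U₁.ι ⁻¹ᵁ Zc)).ι i₂, pushout.desc (ρ ≫ U₁.ι) Zc.ι hi₂π.symm,
    pushout.inl _ _, pushout.inr _ _, inferInstance, inferInstance, pushout.inl_desc _ _ _,
    pushout.inr_desc _ _ _, pushout_cases _ _, fun x' => ⟨?_, fun hx' => ?_⟩,
    fun x' => ⟨?_, fun hx' => ?_⟩⟩
  · rintro ⟨y, rfl⟩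
    rw [← Scheme.Hom.comp_apply, pushout.inl_desc, Scheme.Hom.comp_apply]
    exact (ρ y).2
  · rcases pushout_cases _ i₂ x' with ⟨y, rfl⟩ | ⟨z, rfl⟩
    · exact ⟨y, rfl⟩
    · rw [← Scheme.Hom.comp_apply, pushout.inr_desc] at hx'
      -- `z ∈ Zc ∩ U₁` is hit by `i₂`
      obtain ⟨v, hv⟩ := (ρ ∣_ (U₁.ι ⁻¹ᵁ Zc)).surjective ⟨⟨z.1, hx'⟩, z.2⟩
      have hvz : i₂ v = z := by
        apply Subtype.ext
        rw [hi₂pt, ← morphismRestrict_base_coe ρ (U₁.ι ⁻¹ᵁ Zc) v, hv]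
        rfl
      exact ⟨(ρ ⁻¹ᵁ (U₁.ι ⁻¹ᵁ Zc)).ι v, by
        rw [← Scheme.Hom.comp_apply, pushout.condition, Scheme.Hom.comp_apply, hvz]⟩
  · rintro ⟨z, rfl⟩
    rw [← Scheme.Hom.comp_apply, pushout.inr_desc]
    exact z.2
  · rcases pushout_cases _ i₂ x' with ⟨y, rfl⟩ | ⟨z, rfl⟩
    · rw [← Scheme.Hom.comp_apply, pushout.inl_desc, Scheme.Hom.comp_apply] at hx'
      exact ⟨i₂ ⟨y, hx'⟩, by
        rw [← Scheme.Hom.comp_apply, ← pushout.condition, Scheme.Hom.comp_apply]; rfl⟩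
    · exact ⟨z, rfl⟩

/-! ## Consequences of the range descriptions -/

/-- If an open immersion `j : U → X'` over `X` has range `π⁻¹(U)`, then `π` is an isomorphism
over `U`. [folklore] -/
private theorem isIso_morphismRestrict_of_range {X' X : Scheme.{u}} (π : X' ⟶ X) (U : X.Opens)
    (j : (U : Scheme.{u}) ⟶ X') [IsOpenImmersion j] (hj : j ≫ π = U.ι)
    (hr : ∀ x' : X', (∃ u, j u = x') ↔ π x' ∈ U) : IsIso (π ∣_ U) := by
  have hrange : Set.range j = Set.range (π ⁻¹ᵁ U).ι := by
    rw [Scheme.Opens.range_ι]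
    ext x'
    exact hr x'
  have he : (IsOpenImmersion.isoOfRangeEq j (π ⁻¹ᵁ U).ι hrange).hom ≫ (π ∣_ U) = 𝟙 _ := by
    rw [← cancel_mono U.ι, Category.assoc, morphismRestrict_ι, Category.id_comp,
      IsOpenImmersion.isoOfRangeEq_hom_fac_assoc, hj]
  rw [(Iso.hom_comp_eq_id _).mp he]
  infer_instance

/-- If an open immersion `j : Y → X'` has range `π⁻¹(U)` and `j ≫ π = ρ ≫ U.ι` with `ρ` proper,
then `π` is proper over `U`. [folklore] -/
private theorem isProper_morphismRestrict_of_range {X' X Y : Scheme.{u}} (π : X' ⟶ X)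
    (U : X.Opens) (ρ : Y ⟶ U) [IsProper ρ] (j : Y ⟶ X') [IsOpenImmersion j]
    (hj : j ≫ π = ρ ≫ U.ι) (hr : ∀ x' : X', (∃ y, j y = x') ↔ π x' ∈ U) :
    IsProper (π ∣_ U) := by
  have hrange : Set.range j = Set.range (π ⁻¹ᵁ U).ι := by
    rw [Scheme.Opens.range_ι]
    ext x'
    exact hr x'
  have he : (IsOpenImmersion.isoOfRangeEq j (π ⁻¹ᵁ U).ι hrange).hom ≫ (π ∣_ U) = ρ := by
    rw [← cancel_mono U.ι, Category.assoc, morphismRestrict_ι,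
      IsOpenImmersion.isoOfRangeEq_hom_fac_assoc, hj]
  have : π ∣_ U = (IsOpenImmersion.isoOfRangeEq j (π ⁻¹ᵁ U).ι hrange).inv ≫ ρ := by
    rw [← he, Iso.inv_hom_id_assoc]
  rw [this]
  infer_instance

/-- A scheme covered by two open immersions from reduced schemes is reduced (reducedness is a
property of the stalks). [folklore] -/
private theorem isReduced_of_jointly_surjective {X' Y Z : Scheme.{u}} [IsReduced Y] [IsReduced Z]
    (inl : Y ⟶ X') (inr : Z ⟶ X') [IsOpenImmersion inl] [IsOpenImmersion inr]
    (h : ∀ x' : X', (∃ y, inl y = x') ∨ (∃ z, inr z = x')) : IsReduced X' := by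
  have key : ∀ x' : X', _root_.IsReduced (X'.presheaf.stalk x') := by
    intro x'
    rcases h x' with ⟨y, rfl⟩ | ⟨z, rfl⟩
    · exact isReduced_of_injective _ (asIso <| inl.stalkMap y).commRingCatIsoToRingEquiv.injective
    · exact isReduced_of_injective _ (asIso <| inr.stalkMap z).commRingCatIsoToRingEquiv.injective
  exact isReduced_of_isReduced_stalk _

/-- `dim X ≤ n` iff every point has coheight `≤ n` in the specialisation order (irreducible closed
subsets of the sober space `X` are closures of points). [folklore] -/
private theorem topologicalKrullDim_le_iff_coheight_le (S : Scheme.{u}) (n : ℕ) :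
    topologicalKrullDim S ≤ n ↔ ∀ s : S, Order.coheight s ≤ n := by
  have h : topologicalKrullDim S = Order.krullDim S :=
    Order.krullDim_eq_of_orderIso (irreducibleSetEquivPoints (α := S))
  rw [h, Order.krullDim_eq_iSup_coheight, iSup_le_iff]
  exact forall_congr' fun s => by exact_mod_cast Iff.rfl

/-- A scheme covered by two open immersions from schemes of dimension `≤ n` has dimension `≤ n`
(coheights of points are unchanged under open immersions, Stacks 02I4). [cite: StacksProject, Tag 02I4] -/
private theorem topologicalKrullDim_le_of_jointly_surjective {X' Y Z : Scheme.{u}} {n : ℕ}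
    (inl : Y ⟶ X') (inr : Z ⟶ X') [IsOpenImmersion inl] [IsOpenImmersion inr]
    (h : ∀ x' : X', (∃ y, inl y = x') ∨ (∃ z, inr z = x'))
    (hY : topologicalKrullDim Y ≤ n) (hZ : topologicalKrullDim Z ≤ n) :
    topologicalKrullDim X' ≤ n := by
  rw [topologicalKrullDim_le_iff_coheight_le] at hY hZ ⊢
  intro x'
  rcases h x' with ⟨y, rfl⟩ | ⟨z, rfl⟩
  · rw [coheight_eq_of_isOpenImmersion]
    exact hY y
  · rw [coheight_eq_of_isOpenImmersion]
    exact hZ z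

/-- **Open immersions preserve the Hilbert–Samuel function** (variant of
`Scheme.hsFun_eq_of_isOpenImmersion` with the Noetherian hypothesis on the source, so that it applies
to the charts of the glued scheme before that scheme is known to be locally Noetherian).
[cite: CossartJannsenSaito2020, Def. 2.28] -/
private theorem hsFun_eq_of_isOpenImmersion' {X Y : Scheme.{u}} (f : X ⟶ Y)
    [IsLocallyNoetherian X] [IsOpenImmersion f] (N : ℕ) (x : X) :
    Scheme.hsFun X N x = Scheme.hsFun Y N (f x) := by
  rw [Scheme.hsFun, Scheme.hsFun, Scheme.hsPhi_eq_of_isIso_stalkMap f N x]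
  exact hilbertSamuelFun_eq_of_ringEquiv
    (asIso (f.stalkMap x)).commRingCatIsoToRingEquiv.symm _

/-! ## Gluing a local `ν`-witness by the identity off the stratum -/

/-- **`ν`-GLUING — a witness given over an open neighbourhood of the stratum `X(ν)` extends by the
identity to a `ν`-modification** (CJS Def. 6.14 / Rem. 6.24 bookkeeping; gluing of schemes along an
open, Stacks 01LH). Let `X` be reduced, locally Noetherian, of dimension `≤ d` and `≤ N`, covered by
the opens `Zc = X ∖ X(ν)` and `U₁`, and let `ρ : Y → U₁` be proper with `Y` reduced of dimension `≤ d`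
and `≤ N`, an isomorphism over `U₁ ∩ Zc`, pulling every dense open of `X` inside `X ∖ X(ν)` back to a
dense open of `Y`, with `H^N` non-increasing and `ν ∉ Σ_Y(N)`. Glue `ρ` with the identity of `Zc`
along `ρ⁻¹(U₁ ∩ Zc) ≅ U₁ ∩ Zc`: the result is a `ν`-modification of `X` at level `N` inside the
class `{dim ≤ d}` — proper (Zariski-locally on `X`), reduced with both dimension bounds (through the
two open charts), an isomorphism over every open inside `X ∖ X(ν)`, dense opens inside `X ∖ X(ν)`
pulled back to dense opens (chart by chart), `H^N` non-increasing (the Hilbert–Samuel function is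
local, CJS Def. 2.28), and `ν` not a value upstairs (a value on the chart `Zc` is the value of `Σ_X`
at a point outside `X(ν)`).
[cite: StacksProject, Tag 01LH] [cite: CossartJannsenSaito2020, Def. 6.14, Rem. 6.24] -/
theorem nuMod_of_localWitness :
    ∀ (X : Scheme.{0}) [IsLocallyNoetherian X] [IsReduced X] (N d : ℕ) (ν : ℕ → ℕ),
      topologicalKrullDim X ≤ (d : WithBot ℕ∞) → topologicalKrullDim X ≤ (N : WithBot ℕ∞) →
      ∀ (Zc U₁ : X.Opens), (Zc : Set X) = (Scheme.hsStratum X N ν)ᶜ → Zc ⊔ U₁ = ⊤ →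
      ∀ (Y : Scheme.{0}) (ρ : Y ⟶ (U₁ : Scheme.{0})), IsProper ρ → IsReduced Y →
      topologicalKrullDim Y ≤ (d : WithBot ℕ∞) → topologicalKrullDim Y ≤ (N : WithBot ℕ∞) →
      IsIso (ρ ∣_ (U₁.ι ⁻¹ᵁ Zc)) →
      (∀ U : X.Opens, Dense (U : Set X) → (U : Set X) ⊆ (Scheme.hsStratum X N ν)ᶜ →
        Dense ((ρ ⁻¹ᵁ (U₁.ι ⁻¹ᵁ U) : Y.Opens) : Set Y)) →
      (∀ y : Y, Scheme.hsFun Y N y ≤ Scheme.hsFun X N (U₁.ι.base (ρ.base y))) →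
      ν ∉ Scheme.hsValues Y N →
      NuMod X N d ν := by
  intro X _ _ N d ν hdimXd hdimX Zc U₁ hZc hcov Y ρ hρ hYred hdimYd hdimY hiso hdense hmono hkill
  haveI : IsLocallyNoetherian Y := LocallyOfFiniteType.isLocallyNoetherian ρ
  obtain ⟨X', π, inl, inr, hinl, hinr, hπl, hπr, hcases, hrl, hrr⟩ := exists_glue Zc U₁ ρ
  have hπl' : ∀ y : Y, π (inl y) = U₁.ι (ρ y) := fun y => by
    rw [← Scheme.Hom.comp_apply, hπl, Scheme.Hom.comp_apply]
  have hπr' : ∀ z : Zc, π (inr z) = Zc.ι z := fun z => by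
    rw [← Scheme.Hom.comp_apply, hπr]
  -- `π` is an isomorphism over `Zc` and proper over `U₁`, hence proper
  have hPZ : IsIso (π ∣_ Zc) := isIso_morphismRestrict_of_range π Zc inr hπr hrr
  have hPU : IsProper (π ∣_ U₁) := isProper_morphismRestrict_of_range π U₁ ρ inl hπl hrl
  have hP : IsProper π := by
    apply IsZariskiLocalAtTarget.of_forall_exists_morphismRestrict (P := @IsProper)
    intro x
    by_cases hx : x ∈ Zc
    · exact ⟨Zc, hx, inferInstance⟩
    · refine ⟨U₁, ?_, hPU⟩
      have hx' : x ∈ Zc ⊔ U₁ := by rw [hcov]; exact Opens.mem_top x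
      exact (Opens.mem_sup.mp hx').resolve_left hx
  -- dimension of `Zc ⊆ X`
  have hdimZ : topologicalKrullDim (Zc : Scheme.{0}) ≤ (N : WithBot ℕ∞) :=
    (topologicalKrullDim_subspace_le X (Zc : Set X)).trans hdimX
  have hdimZd : topologicalKrullDim (Zc : Scheme.{0}) ≤ (d : WithBot ℕ∞) :=
    (topologicalKrullDim_subspace_le X (Zc : Set X)).trans hdimXd
  -- the images of the two charts lie in the preimage of an open `U` as soon as their points map to `U`
  have hinlU : ∀ U : X.Opens,
      inl.base '' ((ρ ⁻¹ᵁ (U₁.ι ⁻¹ᵁ U) : Y.Opens) : Set Y) ⊆ ((π ⁻¹ᵁ U : X'.Opens) : Set X') := by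
    rintro U _ ⟨y', hy', rfl⟩
    show π (inl y') ∈ U
    rw [hπl' y']
    exact hy'
  have hinrU : ∀ U : X.Opens,
      inr.base '' ((Zc.ι ⁻¹ᵁ U : (Zc : Scheme.{0}).Opens) : Set (Zc : Scheme.{0})) ⊆
        ((π ⁻¹ᵁ U : X'.Opens) : Set X') := by
    rintro U _ ⟨z', hz', rfl⟩
    show π (inr z') ∈ U
    rw [hπr' z']
    exact hz'
  refine ⟨X', π, hP, isReduced_of_jointly_surjective inl inr hcases,
    topologicalKrullDim_le_of_jointly_surjective inl inr hcases hdimYd hdimZd,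
    topologicalKrullDim_le_of_jointly_surjective inl inr hcases hdimY hdimZ, ?_, ?_, ?_, ?_⟩
  · -- isomorphism over every open inside `X ∖ X(ν) = Zc`
    intro U hU
    refine isIso_morphismRestrict_of_le π hPZ fun x hx => ?_
    have hx' : x ∈ (Scheme.hsStratum X N ν)ᶜ := hU hx
    rwa [← hZc] at hx'
  · -- dense opens inside `X ∖ X(ν)` pull back to dense opens: check on the two charts
    intro U hUd hU
    rw [dense_iff_closure_eq, Set.eq_univ_iff_forall]
    intro x'
    rcases hcases x' with ⟨y, rfl⟩ | ⟨z, rfl⟩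
    · -- chart `Y`: `ρ⁻¹(U ∩ U₁)` is dense in `Y`
      have h1 : inl.base '' closure ((ρ ⁻¹ᵁ (U₁.ι ⁻¹ᵁ U) : Y.Opens) : Set Y) ⊆
          closure (inl.base '' ((ρ ⁻¹ᵁ (U₁.ι ⁻¹ᵁ U) : Y.Opens) : Set Y)) :=
        image_closure_subset_closure_image inl.continuous
      have h3 : inl y ∈ inl.base '' closure ((ρ ⁻¹ᵁ (U₁.ι ⁻¹ᵁ U) : Y.Opens) : Set Y) :=
        ⟨y, by rw [(hdense U hUd hU).closure_eq]; exact Set.mem_univ y, rfl⟩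
      exact closure_mono (hinlU U) (h1 h3)
    · -- chart `Zc`: `U ∩ Zc` is dense in the open `Zc`
      have hZd : Dense ((Zc.ι ⁻¹ᵁ U : (Zc : Scheme.{0}).Opens) : Set (Zc : Scheme.{0})) :=
        hUd.preimage Zc.2.isOpenMap_subtype_val
      have h1 : inr.base '' closure ((Zc.ι ⁻¹ᵁ U : (Zc : Scheme.{0}).Opens) : Set (Zc : Scheme.{0})) ⊆
          closure (inr.base '' ((Zc.ι ⁻¹ᵁ U : (Zc : Scheme.{0}).Opens) : Set (Zc : Scheme.{0}))) :=
        image_closure_subset_closure_image inr.continuous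
      have h3 : inr z ∈
          inr.base '' closure ((Zc.ι ⁻¹ᵁ U : (Zc : Scheme.{0}).Opens) : Set (Zc : Scheme.{0})) :=
        ⟨z, by rw [hZd.closure_eq]; exact Set.mem_univ z, rfl⟩
      exact closure_mono (hinrU U) (h1 h3)
  · -- `H^N` is non-increasing
    intro x'
    rcases hcases x' with ⟨y, rfl⟩ | ⟨z, rfl⟩
    · rw [← hsFun_eq_of_isOpenImmersion' inl N y, hπl' y]
      exact hmono y
    · rw [← hsFun_eq_of_isOpenImmersion' inr N z, hπr' z, Scheme.hsFun_opens]
  · -- `ν` is not a value upstairs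
    rintro ⟨x', hx'⟩
    rcases hcases x' with ⟨y, rfl⟩ | ⟨z, rfl⟩
    · exact hkill ⟨y, by rw [hsFun_eq_of_isOpenImmersion' inl N y, hx']⟩
    · have hz : z.1 ∈ (Zc : Set X) := z.2
      rw [hZc] at hz
      apply hz
      rw [Scheme.mem_hsStratum_iff, ← hx', ← hsFun_eq_of_isOpenImmersion' inr N z]
      exact (Scheme.hsFun_opens Zc N z).symm

end Summit.ResolutionOfSingularities.ResolutionOfSingularities.Theorems.SigmaMaxModificationsCorridor3.TameWild

end
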